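import Summits.ResolutionOfSingularities.ResolutionOfSingularities.Theorems.PurelyInseparableDim4ComponentThreads
import Summits.ResolutionOfSingularities.ResolutionOfSingularities.Theorems.PurelyInseparableDim4KeptMultiplicity
import Literature.AlgebraicGeometry.Resolution.PointBlowupKangaroo
import HarnessLib

/-!
# [OURS · res-dim4-pi · F4-C] COMPONENT THREADS, part 2 — LEMMA B2 (dimension is recharged at the chart
  origin only inside the new exceptional hyperplane) and LEMMA T1 in EXACT form (every field, every `q`)

Cell `res-dim4-pi` (D-0157 DOOR 2, wave 2); continuation of `PurelyInseparableDim4ComponentThreads.lean`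
(CARD I-2-6 / I-2-6a «COMPONENT THREADS» of `res-dim4-idea-2` g2, sketch f98eed99a9731357).  §5 is idea-2's
(typed and proved in the sketch, landed verbatim up to the namespace by `res-dim4-p-6` g2); §6 is p-6's.

* §5 (idea-2) **LEMMA B2** `ordAlong_step_origin_of_not_mem` (clean parent, `q ≤ ord_{C_S} F`, chart `j`,
  point `b = 0` ⇒ `ord_{T'}` unchanged for every `T' ∌ j`), `mem_of_permissible_child_card_lt` (blow up a
  permissible coordinate centre of MAXIMAL dimension: every LARGER-dimensional permissible coordinate subspace
  of the origin-child lies in `{x_j = 0}` — no UP-STRICT at `t = 0`; engines: 0 / 1,088,018 logged edges,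
  crit-1 V-A-24 0 / 170,424 own replays), `permissible_parent_of_not_mem` (lateral ties at `t = 0` pre-exist).
* §6 (p-6) **LEMMA T1, EXACT form** `suppS_step_eq`: for a CLEAN parent with `q ≤ ord_{C_S} F` the thread
  datum of the child at `b|_S = 0` IS the `spineMove`-image of the parent's — EVERY field and EVERY `q` (the
  card's `CharP`/`q = p^e` proviso is not needed): an undominated monomial of each `S`-class keeps its
  coefficient under the off-`S` translation (`KeptMultiplicity.exists_coeff_translate_eq_of_layer`) and, the
  chart transform of a clean permissible parent being clean (`Perm2Bound.deletePthPowers_chartTransform`), is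
  not a `q`-th power, so it survives the cleaning.  Hence idea-2's typed `ComponentThreads.TransversalDictionary
  p e` holds for all `p, e` (`transversalDictionary`), the thread game is played EXACTLY (`legal_suppS_step_iff`),
  `ord_T` for `T ⊆ S` is read off the thread datum (`ordAlong_eq_inf_suppS`, `degIn_eq_sum_classOf`), and along-centre moves do
  not recharge `ord_T` for `T ⊆ S ∖ {j}` (`ordAlong_step_of_subset_erase`,
  `isPermissibleCentre_step_iff_of_subset_erase`: B2 off the origin inside the old centre directions).

Scope (honest): statements about OUR coordinate-centre frame (`CentreBlowup.step`); the `:fib` steps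
(`b|_S ≠ 0`) and FINITE-SWITCHES of CARD I-2-6 §T3 are NOT touched.  [OURS · counted 0 · elementary kernel
bookkeeping; AI kernel work, weaker than expert review.]  NOTHING here is a statement about resolution of
singularities; resolution in dimension `≥ 4` / characteristic `p > 0` is NOT proved by anything in this file.
bears_on: LADDER-RESOLUTION:D157-DOOR2 (res-dim4-pi · F4-C component threads).  Host item (DR-157-C):
`stmt-ResolutionOfSingularities-16155` (`MarkedTransfer.HypersurfaceOrderReduction`), helper.
-/

noncomputable section

set_option linter.dupNamespace false -- mandated namespace of this single-conjunct summit

open MvPolynomial Finset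
open scoped BigOperators

namespace Summit.ResolutionOfSingularities.ResolutionOfSingularities.Theorems.PIDim4

namespace ComponentThreads

open Literature.AlgebraicGeometry.Resolution
open Literature.AlgebraicGeometry.Resolution.Hauser2010
open Summit.ResolutionOfSingularities.ResolutionOfSingularities.Theorems.PIDim4.IsoSpine

/-! ## 5. LEMMA B2 (card I-2-6a §A): at the chart origin, dimension is recharged only inside the new
exceptional hyperplane -/

section B2

variable {K : Type} [Field K] [DecidableEq K]

omit [DecidableEq K] in
/-- pointwise form of permissibility. OURS. [folklore] -/
theorem forall_le_degIn_of_le_ordAlong {q : ℕ} {S : Finset (Fin 4)} {F : MvPolynomial (Fin 4) K}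
    (h : (q : ℕ∞) ≤ CentreBlowup.ordAlong S F) : ∀ e ∈ F.support, q ≤ CentreBlowup.degIn S e := by
  intro e he
  unfold CentreBlowup.ordAlong at h
  exact_mod_cast (Finset.le_inf_iff.mp h) e he

omit [DecidableEq K] in
/-- the support of the chart transform under permissibility: the `chartExponent`-image. OURS. [folklore] -/
theorem support_chartTransform_eq_image {q : ℕ} {S : Finset (Fin 4)} {j : Fin 4} (hj : j ∈ S)
    {F : MvPolynomial (Fin 4) K} (hq : ∀ e ∈ F.support, q ≤ CentreBlowup.degIn S e) :
    (CentreBlowup.chartTransform q S j F).support = F.support.image (CentreBlowup.chartExponent q S j) := by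
  classical
  ext E
  constructor
  · intro hE
    obtain ⟨e, he, rfl⟩ := Perm2Bound.exists_of_mem_support_chartTransform q S j F hE
    exact Finset.mem_image.mpr ⟨e, he, rfl⟩
  · intro hE
    obtain ⟨e, he, rfl⟩ := Finset.mem_image.mp hE
    exact (Perm2Bound.mem_support_chartTransform_iff hj hq (hq e he)).mpr he

omit [DecidableEq K] in
/-- the chart exponent law does not touch `degIn T'` for `j ∉ T'`. OURS. [folklore] -/
theorem degIn_chartExponent_of_not_mem (q : ℕ) (S : Finset (Fin 4)) {j : Fin 4} {T' : Finset (Fin 4)}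
    (hjT : j ∉ T') (d : Fin 4 →₀ ℕ) :
    CentreBlowup.degIn T' (CentreBlowup.chartExponent q S j d) = CentreBlowup.degIn T' d := by
  unfold CentreBlowup.degIn CentreBlowup.chartExponent
  refine Finset.sum_congr rfl (fun i hi => ?_)
  rw [Finsupp.update_apply, if_neg]
  rintro rfl
  exact hjT hi

/-- **At the chart origin (`b = 0`), for a clean parent and a permissible `C_S`, `ord_{T'}` is
UNCHANGED for every `T' ∌ j`.** OURS (res-dim4-idea-2, CARD I-2-6a LEMMA B2). [folklore] -/
theorem ordAlong_step_origin_of_not_mem (q : ℕ) (S : Finset (Fin 4)) {j : Fin 4} (hj : j ∈ S)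
    (s : State K) (hclean : deletePthPowers q s.F = s.F)
    (hq : (q : ℕ∞) ≤ CentreBlowup.ordAlong S s.F) {T' : Finset (Fin 4)} (hjT : j ∉ T') :
    CentreBlowup.ordAlong T' (CentreBlowup.step q S j (0 : Fin 4 → K) s).F =
      CentreBlowup.ordAlong T' s.F := by
  classical
  have hq' := forall_le_degIn_of_le_ordAlong hq
  change CentreBlowup.ordAlong T' (deletePthPowers q (PointBlowup.translate (0 : Fin 4 → K)
    (CentreBlowup.chartTransform q S j s.F))) = _
  rw [PointBlowup.translate_zero, Perm2Bound.deletePthPowers_chartTransform hj hq' hclean]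
  unfold CentreBlowup.ordAlong
  rw [support_chartTransform_eq_image hj hq', Finset.inf_image]
  refine Finset.inf_congr rfl (fun d _ => ?_)
  simp only [Function.comp_apply]
  rw [degIn_chartExponent_of_not_mem q S hjT]

/-- **LEMMA B2**: blow up a coordinate centre `C_S` of MAXIMAL DIMENSION among the permissible ones
(clean parent), chart `j`, point `b = 0`.  Every permissible coordinate subspace of the child of
dimension LARGER than `C_S` lies inside the new exceptional hyperplane `{x_j = 0}` (`j ∈ T'`): at the
chart origin dimension is recharged only inside the exceptional divisor (no UP-STRICT at `t = 0`). OURS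
(res-dim4-idea-2, CARD I-2-6a LEMMA B2). [folklore] -/
theorem mem_of_permissible_child_card_lt (q : ℕ) (S : Finset (Fin 4)) {j : Fin 4} (hj : j ∈ S)
    (s : State K) (hclean : deletePthPowers q s.F = s.F) (hS : IsPermissibleCentre q S s.F)
    (hmax : ∀ T : Finset (Fin 4), IsPermissibleCentre q T s.F → S.card ≤ T.card)
    {T' : Finset (Fin 4)}
    (hT' : IsPermissibleCentre q T' (CentreBlowup.step q S j (0 : Fin 4 → K) s).F)
    (hlt : T'.card < S.card) : j ∈ T' := by
  by_contra hjT
  have hpar : IsPermissibleCentre q T' s.F := by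
    refine ⟨hT'.1, ?_⟩
    rw [← ordAlong_step_origin_of_not_mem q S hj s hclean hS.2 hjT]
    exact hT'.2
  exact absurd (hmax T' hpar) (not_le.mpr hlt)

/-- **B2, lateral form**: a permissible coordinate subspace of the child of the SAME dimension as
`C_S` and not inside `{x_j = 0}` was already permissible at the parent (a pre-existing tie). OURS
(res-dim4-idea-2, CARD I-2-6a). [folklore] -/
theorem permissible_parent_of_not_mem (q : ℕ) (S : Finset (Fin 4)) {j : Fin 4} (hj : j ∈ S)
    (s : State K) (hclean : deletePthPowers q s.F = s.F) (hS : IsPermissibleCentre q S s.F)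
    {T' : Finset (Fin 4)} (hjT : j ∉ T')
    (hT' : IsPermissibleCentre q T' (CentreBlowup.step q S j (0 : Fin 4 → K) s).F) :
    IsPermissibleCentre q T' s.F := by
  refine ⟨hT'.1, ?_⟩
  rw [← ordAlong_step_origin_of_not_mem q S hj s hclean hS.2 hjT]
  exact hT'.2

end B2

/-! ## 6. LEMMA T1, EXACT form (res-dim4-p-6): every class of a clean permissible parent survives the
step — every field, every `q` -/

section Exact

variable {K : Type} [Field K] [DecidableEq K]

omit [DecidableEq K] in
/-- **An undominated monomial of every class layer keeps its coefficient.**  For `b|_S = 0` and any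
monomial `x^{E₀}` of `G` there is a monomial `x^γ` of `G` of the same `S`-class whose coefficient in
`translate b G` is its coefficient in `G`: the class layer `{E ∈ supp G : E|_S = E₀|_S}` is
domination-closed (dominators agree at the untranslated coordinates `i ∈ S`), so
`KeptMultiplicity.exists_coeff_translate_eq_of_layer` applies. OURS (elementary). [folklore] -/
theorem exists_classEq_coeff_translate_eq (S : Finset (Fin 4)) (b : Fin 4 → K)
    (hb : ∀ i ∈ S, b i = 0) (G : MvPolynomial (Fin 4) K) {E₀ : Fin 4 →₀ ℕ} (hE₀ : E₀ ∈ G.support) :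
    ∃ γ ∈ G.support, classOf S γ = classOf S E₀ ∧
      coeff γ (PointBlowup.translate b G) = coeff γ G := by
  classical
  obtain ⟨γ, hγA, hγ⟩ := KeptMultiplicity.exists_coeff_translate_eq_of_layer b G
    (G.support.filter fun E => classOf S E = classOf S E₀) ⟨E₀, Finset.mem_filter.mpr ⟨hE₀, rfl⟩⟩
    (fun γ hγ e he _ hagree => by
      rw [Finset.mem_filter] at hγ ⊢
      refine ⟨he, ?_⟩
      rw [← hγ.2]
      funext i
      exact (hagree _ (hb _ (Finset.orderEmbOfFin_mem S rfl i))).symm)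
  rw [Finset.mem_filter] at hγA
  exact ⟨γ, hγA.1, hγA.2, hγ⟩

/-- **LEMMA T1, EXACT form — every field, every `q`.**  For a CLEAN parent (`deletePthPowers q s.F = s.F`)
with `q ≤ ord_{C_S} F`, a chart `j ∈ S` and a point `b` of the chart with `b|_S = 0`, the thread datum of
the child `CentreBlowup.step q S j b s` IS the `spineMove`-image of the parent's.  `⊆` is
`suppS_step_subset`; `⊇`: the chart transform `G` of a clean permissible parent is clean
(`Perm2Bound.deletePthPowers_chartTransform`) and carries the class of `chartExponent e` for every
monomial `x^e` of `F`; an undominated monomial `x^γ` of that class keeps its (non-zero) coefficient under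
the translation (`exists_classEq_coeff_translate_eq`) and, not being a `q`-th power (`G` clean), under the
cleaning. OURS (res-dim4-p-6; the card's `CharP`/`q = p^e` proviso is not needed). [folklore] -/
theorem suppS_step_eq (q : ℕ) (S : Finset (Fin 4)) (j : Fin 4) (hj : j ∈ S) (b : Fin 4 → K)
    (hb : ∀ i ∈ S, b i = 0) (s : State K) (hclean : deletePthPowers q s.F = s.F)
    (hq : (q : ℕ∞) ≤ CentreBlowup.ordAlong S s.F) :
    suppS S (CentreBlowup.step q S j b s).F = (suppS S s.F).image (spineMove q (idxS S j hj)) := by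
  classical
  refine Finset.Subset.antisymm (suppS_step_subset q S j hj b hb s) ?_
  intro a ha
  obtain ⟨m, hm, rfl⟩ := Finset.mem_image.mp ha
  obtain ⟨e, he, rfl⟩ := Finset.mem_image.mp hm
  have hq' := forall_le_degIn_of_le_ordAlong hq
  -- the chart transform is clean and carries the monomial `chartExponent e`
  have hGclean : deletePthPowers q (CentreBlowup.chartTransform q S j s.F) =
      CentreBlowup.chartTransform q S j s.F :=
    Perm2Bound.deletePthPowers_chartTransform hj hq' hclean
  have hE₀ : CentreBlowup.chartExponent q S j e ∈ (CentreBlowup.chartTransform q S j s.F).support :=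
    (Perm2Bound.mem_support_chartTransform_iff hj hq' (hq' e he)).mpr he
  obtain ⟨γ, hγG, hcls, hcoeff⟩ :=
    exists_classEq_coeff_translate_eq S b hb (CentreBlowup.chartTransform q S j s.F) hE₀
  -- `γ` is not a `q`-th power exponent (the chart transform is clean) …
  have hγpow : ¬ IsPthPowerExponent q γ := by
    intro hpow
    have h := MvPolynomial.mem_support_iff.mp hγG
    rw [← hGclean, coeff_deletePthPowers, if_pos hpow] at h
    exact h rfl
  -- … so it survives translation and cleaning
  have hγ' : γ ∈ (CentreBlowup.step q S j b s).F.support := by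
    change γ ∈ (deletePthPowers q (PointBlowup.translate b
      (CentreBlowup.chartTransform q S j s.F))).support
    rw [MvPolynomial.mem_support_iff, coeff_deletePthPowers, if_neg hγpow, hcoeff]
    exact MvPolynomial.mem_support_iff.mp hγG
  refine Finset.mem_image.mpr ⟨γ, hγ', ?_⟩
  rw [hcls, classOf_chartExponent q S j hj e]

/-- **`TransversalDictionary p e` holds for all `p, e`** — idea-2's typed LEMMA T1 (exact form) is a
theorem; the `CharP K p` hypothesis of the typed statement is not used (`suppS_step_eq`). OURS
(res-dim4-p-6). [folklore] -/
theorem transversalDictionary (p e : ℕ) : TransversalDictionary p e := by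
  intro K _ _ _ S j hj b hb s hclean hq
  exact suppS_step_eq (p ^ e) S j hj b hb s hclean hq

/-- **The thread game is played EXACTLY** (not only on sub-supports): along a step at `b|_S = 0` from a
clean parent with `q ≤ ord_{C_S} F`, the child's thread datum is Legal iff the moved parent datum is, and
likewise for PointOnly — literal rewriting by `suppS_step_eq`. OURS (res-dim4-p-6). [folklore] -/
theorem legal_suppS_step_iff (q : ℕ) (S : Finset (Fin 4)) (j : Fin 4) (hj : j ∈ S) (b : Fin 4 → K)
    (hb : ∀ i ∈ S, b i = 0) (s : State K) (hclean : deletePthPowers q s.F = s.F)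
    (hq : (q : ℕ∞) ≤ CentreBlowup.ordAlong S s.F) :
    (Legal q (suppS S (CentreBlowup.step q S j b s).F) ↔
        Legal q ((suppS S s.F).image (spineMove q (idxS S j hj)))) ∧
      (PointOnly q (suppS S (CentreBlowup.step q S j b s).F) ↔
        PointOnly q ((suppS S s.F).image (spineMove q (idxS S j hj)))) := by
  rw [suppS_step_eq q S j hj b hb s hclean hq]
  exact ⟨Iff.rfl, Iff.rfl⟩

/-- for `T ⊆ S`, `degIn T d` is the `T`-DEGREE of the class of `d`: the sum of its coordinates at the
positions enumerating `T`. OURS. [folklore] -/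
theorem degIn_eq_sum_classOf (S : Finset (Fin 4)) {T : Finset (Fin 4)} (hTS : T ⊆ S)
    (d : Fin 4 →₀ ℕ) :
    CentreBlowup.degIn T d = ∑ i, if (S.orderEmbOfFin rfl i : Fin 4) ∈ T then classOf S d i else 0 := by
  classical
  unfold CentreBlowup.degIn classOf
  have h1 : ∑ i : Fin S.card,
      (if (S.orderEmbOfFin rfl i : Fin 4) ∈ T then d (S.orderEmbOfFin rfl i) else 0) =
      ∑ x : S, (if (x : Fin 4) ∈ T then d x else 0) := by
    refine Fintype.sum_equiv (S.orderIsoOfFin rfl).toEquiv _ _ (fun i => ?_)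
    simp [Finset.coe_orderIsoOfFin_apply]
  rw [h1, Finset.sum_coe_sort S (fun x => if x ∈ T then d x else 0), ← Finset.sum_filter,
    Finset.filter_mem_eq_inter, Finset.inter_eq_right.mpr hTS]

/-- the `T`-degree of a class is untouched by `spineMove` at a position outside `T`. OURS. [folklore] -/
theorem sum_spineMove_of_not_mem (q : ℕ) (S : Finset (Fin 4)) {T : Finset (Fin 4)} {j : Fin 4}
    (hj : j ∈ S) (hjT : j ∉ T) (m : Fin S.card → ℕ) :
    (∑ i, if (S.orderEmbOfFin rfl i : Fin 4) ∈ T then spineMove q (idxS S j hj) m i else 0) =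
      ∑ i, if (S.orderEmbOfFin rfl i : Fin 4) ∈ T then m i else 0 := by
  refine Finset.sum_congr rfl (fun i _ => ?_)
  split_ifs with h
  · have hij : i ≠ idxS S j hj := by
      intro hi
      rw [hi, orderEmbOfFin_idxS] at h
      exact hjT h
    exact spineMove_apply_of_ne q hij m
  · rfl

omit [DecidableEq K] in
/-- `ord_T F` for `T ⊆ S` is read off the thread datum: the least `T`-degree of a class. OURS. [folklore] -/
theorem ordAlong_eq_inf_suppS (S : Finset (Fin 4)) {T : Finset (Fin 4)} (hTS : T ⊆ S)
    (F : MvPolynomial (Fin 4) K) :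
    CentreBlowup.ordAlong T F = (suppS S F).inf fun m =>
      ((∑ i, if (S.orderEmbOfFin rfl i : Fin 4) ∈ T then m i else 0 : ℕ) : ℕ∞) := by
  classical
  unfold CentreBlowup.ordAlong suppS
  rw [Finset.inf_image]
  refine Finset.inf_congr rfl (fun d _ => ?_)
  simp only [Function.comp_apply]
  rw [degIn_eq_sum_classOf S hTS d]

/-- **B2 along the centre, inside the old centre directions**: for a clean parent with
`q ≤ ord_{C_S} F`, chart `j ∈ S` and ANY point `b` with `b|_S = 0` (moving along `C_S` allowed),
`ord_T` of the child equals `ord_T` of the parent for every `T ⊆ S ∖ {j}` — the `T`-degree of a class is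
untouched by `spineMove` at `j ∉ T`, and the classes correspond exactly (`suppS_step_eq`).  (For `T`
meeting the off-`S` directions this fails off the origin; at `b = 0` it is `ordAlong_step_origin_of_not_mem`
for every `T ∌ j`.) OURS (res-dim4-p-6). [folklore] -/
theorem ordAlong_step_of_subset_erase (q : ℕ) (S : Finset (Fin 4)) (j : Fin 4) (hj : j ∈ S)
    (b : Fin 4 → K) (hb : ∀ i ∈ S, b i = 0) (s : State K) (hclean : deletePthPowers q s.F = s.F)
    (hq : (q : ℕ∞) ≤ CentreBlowup.ordAlong S s.F) {T : Finset (Fin 4)} (hT : T ⊆ S.erase j) :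
    CentreBlowup.ordAlong T (CentreBlowup.step q S j b s).F = CentreBlowup.ordAlong T s.F := by
  classical
  have hTS : T ⊆ S := hT.trans (Finset.erase_subset j S)
  have hjT : j ∉ T := fun h => Finset.notMem_erase j S (hT h)
  rw [ordAlong_eq_inf_suppS S hTS, ordAlong_eq_inf_suppS S hTS, suppS_step_eq q S j hj b hb s hclean hq,
    Finset.inf_image]
  refine Finset.inf_congr rfl (fun m _ => ?_)
  simp only [Function.comp_apply]
  rw [sum_spineMove_of_not_mem q S hj hjT m]

/-- **Permissible coordinate subspaces inside the old centre directions are neither created nor destroyed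
by a step at `b|_S = 0`** (`T ⊆ S ∖ {j}`, clean parent, `q ≤ ord_{C_S} F`). OURS (res-dim4-p-6). [folklore] -/
theorem isPermissibleCentre_step_iff_of_subset_erase (q : ℕ) (S : Finset (Fin 4)) (j : Fin 4)
    (hj : j ∈ S) (b : Fin 4 → K) (hb : ∀ i ∈ S, b i = 0) (s : State K)
    (hclean : deletePthPowers q s.F = s.F) (hq : (q : ℕ∞) ≤ CentreBlowup.ordAlong S s.F)
    {T : Finset (Fin 4)} (hT : T ⊆ S.erase j) :
    IsPermissibleCentre q T (CentreBlowup.step q S j b s).F ↔ IsPermissibleCentre q T s.F := by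
  unfold IsPermissibleCentre
  rw [ordAlong_step_of_subset_erase q S j hj b hb s hclean hq hT]

end Exact

end ComponentThreads

end Summit.ResolutionOfSingularities.ResolutionOfSingularities.Theorems.PIDim4

end
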